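import Literature.Analysis.FluidPDE.ForcedFourierDuhamelForcing
import HarnessLib

/-!
# The forcing term of the Fourier–Duhamel formula for a force that is only measurable jointly and
# continuous in time at each frequency

Companion of `ForcedFourierDuhamelForcing.lean` (T. Tao, *Localisation and compactness properties
of the Navier–Stokes global regularity problem*, Anal. PDE 6 (2013) 25–107 = arXiv:1108.1165,
Thm. 5.4 (ii) = arXiv Thm. 31 (ii), p. 18, proved WITH forcing by the contraction of the forced
Duhamel map; the forcing term on the Fourier side is
`F(t, ξ) = forcing c T b t ξ = ∫₀^τ e^{-c‖ξ‖²(τ-s)} b(s, ξ) ds`, `τ = clamp T t`,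
`ForcedFourierDuhamelDefs`). That file proves the class, the algebra and the `X¹/X²`-type bounds
of `F` for force coefficients `b` that are JOINTLY CONTINUOUS on `ℝ × E`. The force coefficients the
velocity equation actually carries are the Leray-PROJECTED coefficients
`b(t, ξ) = P(ξ) b̂_f(t, ξ)`, `P(ξ) = 1 − ξ ⊗ ξ/‖ξ‖²` (`FourierNS.lerayPart`), of the physical force
`f`; since `P(ξ)` has no limit at `ξ = 0`, `ξ ↦ P(ξ) b̂_f(t, ξ)` is continuous at the origin only
when `b̂_f(t, 0) = ∫ f(t, x) dx = 0`, i.e. joint continuity of the projected force FAILS for every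
force with non-zero spatial mean, although Tao's theorem has no such restriction. The projected
coefficients of a Schwartz-on-slab force are, however,

  (M)  jointly (Borel) measurable on `ℝ × E`,
  (Ct) continuous in `t` at every fixed frequency `ξ`,
  (D)  pointwise polynomially decaying of every order, uniformly in `t`,

and this file re-proves every statement of `ForcedFourierDuhamelForcing` under (M) + (Ct) (+ (D)
where the original uses it) — the primed names below — by the same proofs: at a fixed frequency the
integrand `s ↦ e^{-c‖ξ‖²(τ-s)} b(s, ξ)` is continuous ((Ct)), so the componentwise formula, the
divergence-free relation, the conjugation symmetry, the heat gain and continuity of `t ↦ F(t, ξ)`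
go through verbatim, while measurability of the slices `F(t, ·)` and of `uncurry F` (Tonelli in the
integrated bounds) comes from (M) through the strong measurability of parametric integrals
(`MeasureTheory.StronglyMeasurable.integral_prod_right`) instead of from joint continuity:

* `measurable_uncurry_of_continuous_time` — (M) from measurable slices + (Ct) (Carathéodory
  functions are jointly measurable; Mathlib `measurable_uncurry_of_continuous_of_measurable`);
* `continuous_forcing_integrand_time'`, `intervalIntegrable_forcing_integrand'`, `forcing_apply'`,
  `sum_mul_forcing'`, `forcing_conj_symm'`, `continuous_forcing_time'`;
* `stronglyMeasurable_uncurry_forcing'` (joint measurability of `F` on `ℝ × E`),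
  `measurable_forcing_slice'`, `aestronglyMeasurable_forcing_slice'`;
* `norm_sq_mul_enorm_forcing_sq_le'` (the heat gain `‖ξ‖²‖F(t,ξ)‖ₑ² ≤ (2c)⁻¹∫⁻‖b(s,ξ)‖ₑ²`),
  `lintegral_weight_majorant_forcing_sq_le'` (+ `_of_sup'`),
  `lintegral_time_weight_majorant_forcing_sq_le'` (+ `_of_sup'`) — the forcing quantities of the
  forced `X¹/X²` recursion.

(The decay statements `norm_forcing_le`, `hasDecay_forcing`, `exists_hasDecay_forcing`,
`enorm_forcing_le_lintegral`, `majorant_forcing_le` of the original file use neither continuity nor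
measurability and apply as they stand.) No definitions, no named facts.

## Mathlib / tree search

Tree (reused): `forcing`, `clamp`, `heat`, `continuous_heat_comp`, `continuous_clamp`,
`clamp_nonneg`, `clamp_le`, `clamp_of_mem`, `heat_neg`, `heat_le_one` (`NSFourierPicard`,
`ForcedFourierDuhamelDefs`); `enorm_duhamel_sq_le` (`FourierL2Duhamel`); `sq_lintegral_mul_le`
(`FourierL2Convolution`); `majorant_forcing_le`, `enorm_forcing_le_lintegral`
(`ForcedFourierDuhamelForcing`). Mathlib: `measurable_uncurry_of_continuous_of_measurable`,
`MeasureTheory.StronglyMeasurable.integral_prod_right`, `intervalIntegral.integral_of_le`,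
`MeasureTheory.integral_indicator`, `intervalIntegral.continuous_parametric_intervalIntegral_of_continuous`,
`ContinuousLinearMap.intervalIntegral_comp_comm`, `intervalIntegral.intervalIntegral_conj`,
`MeasureTheory.lintegral_lintegral_swap`. `lean search 'forcing_apply|sum_mul_forcing'`: only the
jointly-continuous versions of `ForcedFourierDuhamelForcing`.

## References

* T. Tao, Anal. PDE 6 (2013) 25–107 = arXiv:1108.1165: (7) p. 3, Lemma 2.1 = arXiv Lemma 23
  (energy-duh2) p. 10, Thm. 5.4 = arXiv Thm. 31 (ii) p. 18 with the proof of Thm. 5.1 = arXiv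
  Thm. 28 p. 16. [Tao2011]
-/

noncomputable section

open MeasureTheory Set Function Filter Real Complex intervalIntegral
open scoped ENNReal NNReal ComplexConjugate
open _root_.Topology

namespace Literature.Analysis.FluidPDE.FourierNS

variable {ι : Type*} [Fintype ι]
variable {c T : ℝ} {b : ℝ → EuclideanSpace ℝ ι → ι → ℂ}

/-! ### Joint measurability from measurable slices and continuity in time -/

omit [Fintype ι] in
/-- **A Carathéodory force is jointly measurable**: if every slice `b s` is Borel measurable and
`t ↦ b(t, ξ)` is continuous for every `ξ`, then `uncurry b` is measurable on `ℝ × E` (Mathlib's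
`measurable_uncurry_of_continuous_of_measurable`). [cite: Tao2011, Thm. 5.4 (ii) (arXiv Thm. 31), Duhamel formula (7)] -/
theorem measurable_uncurry_of_continuous_time [Fintype ι] (hbs : ∀ s, Measurable (b s))
    (hbt : ∀ ξ, Continuous fun s => b s ξ) : Measurable (uncurry b) :=
  measurable_uncurry_of_continuous_of_measurable hbt hbs

omit [Fintype ι] in
/-- Slices of a jointly measurable force are measurable. [cite: Tao2011, Thm. 5.4 (ii) (arXiv Thm. 31), Duhamel formula (7)] -/
theorem measurable_slice_of_uncurry [Fintype ι] (hbm : Measurable (uncurry b)) (s : ℝ) :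
    Measurable (b s) :=
  hbm.comp (measurable_const.prodMk measurable_id)

omit [Fintype ι] in
/-- Components at a fixed frequency are continuous in time. [cite: Tao2011, Thm. 5.4 (ii) (arXiv Thm. 31), Duhamel formula (7)] -/
theorem continuous_time_apply [Fintype ι] (hbt : ∀ ξ, Continuous fun s => b s ξ)
    (ξ : EuclideanSpace ℝ ι) (j : ι) : Continuous fun s => b s ξ j :=
  (continuous_apply j).comp (hbt ξ)

/-! ### Continuity in `s` of the integrand; components; incompressibility; conjugation -/

/-- At fixed `(τ, ξ)` the integrand of the forcing term is continuous in `s` (only continuity of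
`s ↦ b(s, ξ)` is used). [cite: Tao2011, Thm. 5.4 (ii) (arXiv Thm. 31), Duhamel formula (7)] -/
theorem continuous_forcing_integrand_time' (hbt : ∀ ξ, Continuous fun s => b s ξ) (τ : ℝ)
    (ξ : EuclideanSpace ℝ ι) : Continuous fun s : ℝ => heat c ξ (τ - s) • b s ξ :=
  (continuous_heat_comp c continuous_const (continuous_const.sub continuous_id)).smul (hbt ξ)

/-- The integrand of the forcing term is interval integrable in `s`.
[cite: Tao2011, Thm. 5.4 (ii) (arXiv Thm. 31), Duhamel formula (7)] -/
theorem intervalIntegrable_forcing_integrand' (hbt : ∀ ξ, Continuous fun s => b s ξ) (τ : ℝ)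
    (ξ : EuclideanSpace ℝ ι) (t₁ t₂ : ℝ) :
    IntervalIntegrable (fun s : ℝ => heat c ξ (τ - s) • b s ξ) volume t₁ t₂ :=
  (continuous_forcing_integrand_time' hbt τ ξ).intervalIntegrable _ _

/-- Components of the forcing term. [cite: Tao2011, Thm. 5.4 (ii) (arXiv Thm. 31), Duhamel formula (7)] -/
theorem forcing_apply' (hbt : ∀ ξ, Continuous fun s => b s ξ) (t : ℝ) (ξ : EuclideanSpace ℝ ι)
    (l : ι) :
    forcing c T b t ξ l =
      ∫ s in (0 : ℝ)..clamp T t, (heat c ξ (clamp T t - s) : ℂ) * b s ξ l := by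
  have h := ((ContinuousLinearMap.proj (R := ℝ) (φ := fun _ : ι => ℂ) l).intervalIntegral_comp_comm
    (intervalIntegrable_forcing_integrand' (c := c) hbt (clamp T t) ξ 0 (clamp T t)))
  simp only [ContinuousLinearMap.proj_apply, Pi.smul_apply, Complex.real_smul] at h
  rw [forcing, ← h]

/-- **The forcing term is divergence free on the Fourier side when the force coefficients are**:
`∑ₗ ξₗ F(t, ξ)ₗ = 0`. [cite: Tao2011, Thm. 5.4 (ii) (arXiv Thm. 31), Duhamel formula (7)] -/
theorem sum_mul_forcing' (hbt : ∀ ξ, Continuous fun s => b s ξ)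
    (hdiv : ∀ s ξ, ∑ l, ((ξ l : ℝ) : ℂ) * b s ξ l = 0) (t : ℝ) (ξ : EuclideanSpace ℝ ι) :
    ∑ l, ((ξ l : ℝ) : ℂ) * forcing c T b t ξ l = 0 := by
  have hii : ∀ l, IntervalIntegrable (fun s => ((ξ l : ℝ) : ℂ) * ((heat c ξ (clamp T t - s) : ℂ) *
      b s ξ l)) volume 0 (clamp T t) := fun l => by
    have := ((continuous_apply l).comp (continuous_forcing_integrand_time' (c := c) hbt
      (clamp T t) ξ)).const_smul ((ξ l : ℝ) : ℂ)
    refine (this.intervalIntegrable _ _).congr fun s _ => ?_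
    simp [Complex.real_smul]
  have hz : ∀ s, ∑ l, ((ξ l : ℝ) : ℂ) * ((heat c ξ (clamp T t - s) : ℂ) * b s ξ l) = 0 :=
    fun s => by
    calc ∑ l, ((ξ l : ℝ) : ℂ) * ((heat c ξ (clamp T t - s) : ℂ) * b s ξ l)
        = (heat c ξ (clamp T t - s) : ℂ) * ∑ l, ((ξ l : ℝ) : ℂ) * b s ξ l := by
          rw [Finset.mul_sum]; congr 1 with l; ring
      _ = 0 := by rw [hdiv, mul_zero]
  simp_rw [forcing_apply' hbt, ← intervalIntegral.integral_const_mul]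
  rw [← intervalIntegral.integral_finsetSum fun l _ => hii l]
  have : (fun s => ∑ l, ((ξ l : ℝ) : ℂ) * ((heat c ξ (clamp T t - s) : ℂ) * b s ξ l)) =
      fun _ => (0 : ℂ) := funext hz
  rw [this, intervalIntegral.integral_zero]

/-- **Conjugation symmetry of the forcing term**: if `b(s, -ξ) = conj b(s, ξ)` componentwise then
`F(t, -ξ) = conj F(t, ξ)`. [cite: Tao2011, Thm. 5.4 (ii) (arXiv Thm. 31), Duhamel formula (7)] -/
theorem forcing_conj_symm' (hbt : ∀ ξ, Continuous fun s => b s ξ)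
    (hbs : ∀ s ξ l, b s (-ξ) l = conj (b s ξ l)) (t : ℝ) (ξ : EuclideanSpace ℝ ι) (l : ι) :
    forcing c T b t (-ξ) l = conj (forcing c T b t ξ l) := by
  rw [forcing_apply' hbt, forcing_apply' hbt, ← intervalIntegral.intervalIntegral_conj]
  congr 1 with s
  rw [map_mul, Complex.conj_ofReal, heat_neg, hbs]

/-- **At a fixed frequency the forcing term is continuous in time** (parametric interval integral
of an integrand jointly continuous in `(t, s)`; no continuity in `ξ` is needed).
[cite: Tao2011, Thm. 5.4 (ii) (arXiv Thm. 31), Duhamel formula (7)] -/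
theorem continuous_forcing_time' (hbt : ∀ ξ, Continuous fun s => b s ξ) (ξ : EuclideanSpace ℝ ι) :
    Continuous fun t => forcing c T b t ξ := by
  have hF : Continuous (uncurry fun (t s : ℝ) => heat c ξ (clamp T t - s) • b s ξ) := by
    have hg : Continuous fun p : ℝ × ℝ => clamp T p.1 - p.2 := by
      have := continuous_clamp T; fun_prop
    exact (continuous_heat_comp c continuous_const hg).smul ((hbt ξ).comp continuous_snd)
  have h := intervalIntegral.continuous_parametric_intervalIntegral_of_continuous (μ := volume)
    (a₀ := 0) hF (continuous_clamp T)
  exact h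

/-! ### Measurability of the forcing term from joint measurability of the force -/

omit [Fintype ι] in
/-- The set `{((t, ξ), s) | 0 < s ≤ clamp T t}` is measurable. [folklore] -/
private theorem measurableSet_timeSlab [Fintype ι] :
    MeasurableSet {p : (ℝ × EuclideanSpace ℝ ι) × ℝ | 0 < p.2 ∧ p.2 ≤ clamp T p.1.1} := by
  refine (measurableSet_lt measurable_const measurable_snd).inter
    (measurableSet_le measurable_snd ?_)
  exact (continuous_clamp T).measurable.comp (measurable_fst.comp measurable_fst)

/-- **Joint (strong) measurability of the forcing term on `ℝ × E`** for a jointly measurable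
force: `F(t, ξ) = ∫ 1_{(0, clamp T t]}(s) e^{-c‖ξ‖²(clamp T t - s)} b(s, ξ) ds` is the parametric
integral of a jointly measurable integrand. [cite: Tao2011, Thm. 5.4 (ii) (arXiv Thm. 31), Duhamel formula (7)] -/
theorem stronglyMeasurable_uncurry_forcing' (hbm : Measurable (uncurry b)) :
    StronglyMeasurable (uncurry (forcing c T b)) := by
  classical
  -- the integrand with the time indicator built in
  set g : (ℝ × EuclideanSpace ℝ ι) → ℝ → (ι → ℂ) := fun p s =>
    if 0 < s ∧ s ≤ clamp T p.1 then heat c p.2 (clamp T p.1 - s) • b s p.2 else 0 with hg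
  have hgm : StronglyMeasurable (uncurry g) := by
    refine Measurable.stronglyMeasurable ?_
    have h1 : Measurable fun q : (ℝ × EuclideanSpace ℝ ι) × ℝ =>
        heat c q.1.2 (clamp T q.1.1 - q.2) • b q.2 q.1.2 := by
      have hh : Continuous fun q : (ℝ × EuclideanSpace ℝ ι) × ℝ =>
          heat c q.1.2 (clamp T q.1.1 - q.2) := by
        have := continuous_clamp T
        exact continuous_heat_comp c (by fun_prop) (by fun_prop)
      have hb : Measurable fun q : (ℝ × EuclideanSpace ℝ ι) × ℝ => b q.2 q.1.2 :=
        hbm.comp (measurable_snd.prodMk (measurable_snd.comp measurable_fst))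
      exact hh.measurable.smul hb
    refine Measurable.ite measurableSet_timeSlab h1 measurable_const
  have hint : StronglyMeasurable fun p : ℝ × EuclideanSpace ℝ ι => ∫ s, g p s :=
    hgm.integral_prod_right
  have heq : (fun p : ℝ × EuclideanSpace ℝ ι => ∫ s, g p s) = uncurry (forcing c T b) := by
    funext p
    change ∫ s, g p s = forcing c T b p.1 p.2
    rw [forcing, intervalIntegral.integral_of_le (clamp_nonneg T p.1),
      ← MeasureTheory.integral_indicator measurableSet_Ioc]
    refine integral_congr_ae (Eventually.of_forall fun s => ?_)
    simp only [hg, Set.indicator, mem_Ioc]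
  rw [← heq]
  exact hint

/-- Measurable-in-`(t, ξ)` form. [cite: Tao2011, Thm. 5.4 (ii) (arXiv Thm. 31), Duhamel formula (7)] -/
theorem measurable_uncurry_forcing' (hbm : Measurable (uncurry b)) :
    Measurable (uncurry (forcing c T b)) :=
  (stronglyMeasurable_uncurry_forcing' hbm).measurable

/-- **Time slices of the forcing term are measurable** for a jointly measurable force.
[cite: Tao2011, Thm. 5.4 (ii) (arXiv Thm. 31), Duhamel formula (7)] -/
theorem measurable_forcing_slice' (hbm : Measurable (uncurry b)) (t : ℝ) :
    Measurable (forcing c T b t) :=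
  (measurable_uncurry_forcing' hbm).comp (measurable_const.prodMk measurable_id)

/-- A.e.-strongly measurable time slices. [cite: Tao2011, Thm. 5.4 (ii) (arXiv Thm. 31), Duhamel formula (7)] -/
theorem aestronglyMeasurable_forcing_slice' (hbm : Measurable (uncurry b)) (t : ℝ) :
    AEStronglyMeasurable (forcing c T b t) volume :=
  (measurable_forcing_slice' hbm t).aestronglyMeasurable

/-- Joint a.e.-strong measurability on `ℝ × E`. [cite: Tao2011, Thm. 5.4 (ii) (arXiv Thm. 31), Duhamel formula (7)] -/
theorem aestronglyMeasurable_uncurry_forcing' (hbm : Measurable (uncurry b))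
    (μ : Measure (ℝ × EuclideanSpace ℝ ι)) : AEStronglyMeasurable (uncurry (forcing c T b)) μ :=
  (stronglyMeasurable_uncurry_forcing' hbm).aestronglyMeasurable

/-! ### The heat gain -/

/-- **The heat gain of the forcing term**: for `c > 0`, `s ↦ b(s, ξ)` continuous and
`t ∈ [0, T]`, `‖ξ‖² ‖F(t, ξ)‖ₑ² ≤ (2c)⁻¹ ∫⁻_{(0,T]} ‖b(s, ξ)‖ₑ² ds`.
[cite: Tao2011, Lemma 2.1 (arXiv Lemma 23), (energy-duh2)] -/
theorem norm_sq_mul_enorm_forcing_sq_le' (hc : 0 < c) (hbt : ∀ ξ, Continuous fun s => b s ξ)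
    {t : ℝ} (ht : t ∈ Icc 0 T) (ξ : EuclideanSpace ℝ ι) :
    ENNReal.ofReal (‖ξ‖ ^ 2) * ‖forcing c T b t ξ‖ₑ ^ 2 ≤
      ENNReal.ofReal (1 / (2 * c)) * ∫⁻ s in Ioc 0 T, ‖b s ξ‖ₑ ^ 2 := by
  have hN : ∀ s ∈ Icc 0 T, ‖(‖ξ‖ : ℝ) • b s ξ‖ₑ ≤ ENNReal.ofReal ‖ξ‖ * ‖b s ξ‖ₑ := fun s _ => by
    rw [enorm_smul, Real.enorm_eq_ofReal (norm_nonneg ξ)]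
  have hφ : AEMeasurable (fun s => ‖b s ξ‖ₑ) (volume.restrict (Ioc 0 T)) :=
    (hbt ξ).measurable.enorm.aemeasurable
  have h := enorm_duhamel_sq_le (T := T) (ξ := ξ) (N := fun s => (‖ξ‖ : ℝ) • b s ξ)
    (φ := fun s => ‖b s ξ‖ₑ) hc hφ hN ht
  have heq : ∫ s in (0 : ℝ)..t, heat c ξ (t - s) • ((‖ξ‖ : ℝ) • b s ξ) =
      (‖ξ‖ : ℝ) • forcing c T b t ξ := by
    rw [forcing, clamp_of_mem ht, ← intervalIntegral.integral_smul]
    congr 1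
    funext s
    rw [smul_comm]
  rw [heq, enorm_smul, Real.enorm_eq_ofReal (norm_nonneg ξ), mul_pow,
    ← ENNReal.ofReal_pow (norm_nonneg ξ)] at h
  exact h

/-! ### The majorant: pointwise comparisons -/

/-- The sup norm of a finite family is at most the sum of the norms of its entries, in `ℝ≥0∞`
form. [folklore] -/
private theorem enorm_pi_le_majorant' (x : ι → ℂ) : ‖x‖ₑ ≤ ∑ j, ‖x j‖ₑ := by
  have h : ‖x‖ ≤ ∑ j, ‖x j‖ :=
    (pi_norm_le_iff_of_nonneg (Finset.sum_nonneg fun j _ => norm_nonneg (x j))).2 fun j =>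
      Finset.single_le_sum (f := fun j => ‖x j‖) (fun j _ => norm_nonneg (x j)) (Finset.mem_univ j)
  calc ‖x‖ₑ = ENNReal.ofReal ‖x‖ := (ofReal_norm x).symm
    _ ≤ ENNReal.ofReal (∑ j, ‖x j‖) := ENNReal.ofReal_le_ofReal h
    _ = ∑ j, ENNReal.ofReal ‖x j‖ := ENNReal.ofReal_sum_of_nonneg fun j _ => norm_nonneg (x j)
    _ = ∑ j, ‖x j‖ₑ := Finset.sum_congr rfl fun j _ => ofReal_norm (x j)

/-- An entry of a finite family is bounded by the sup norm, in `ℝ≥0∞` form. [folklore] -/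
private theorem enorm_apply_le_enorm_pi' (x : ι → ℂ) (j : ι) : ‖x j‖ₑ ≤ ‖x‖ₑ := by
  rw [← ofReal_norm, ← ofReal_norm]
  exact ENNReal.ofReal_le_ofReal (norm_le_pi_norm x j)

/-- The weighted majorant `(η, s) ↦ (W η ∑ⱼ ‖b(s, η)ⱼ‖ₑ)²` of a jointly measurable `b` is jointly
measurable. [folklore] -/
private theorem aemeasurable_weight_majorant_sq' (hbm : Measurable (uncurry b))
    {W : EuclideanSpace ℝ ι → ℝ≥0∞} (hW : Measurable W) (ν : Measure ℝ) :
    AEMeasurable (uncurry fun (η : EuclideanSpace ℝ ι) (s : ℝ) => (W η * ∑ j, ‖b s η j‖ₑ) ^ 2)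
      ((volume : Measure (EuclideanSpace ℝ ι)).prod ν) := by
  have hM : Measurable (uncurry fun (η : EuclideanSpace ℝ ι) (s : ℝ) => ∑ j, ‖b s η j‖ₑ) := by
    refine Finset.measurable_sum _ fun j _ => ?_
    have hb : Measurable fun p : EuclideanSpace ℝ ι × ℝ => b p.2 p.1 j :=
      (measurable_pi_apply j).comp (hbm.comp (measurable_snd.prodMk measurable_fst))
    exact hb.enorm
  have h : Measurable (uncurry fun (η : EuclideanSpace ℝ ι) (s : ℝ) => (W η * ∑ j, ‖b s η j‖ₑ) ^ 2) :=
    ((hW.comp measurable_fst).mul hM).pow_const 2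
  exact h.aemeasurable

/-- `(∫⁻_{(0,T]} g)² ≤ T ∫⁻_{(0,T]} g²` (Cauchy–Schwarz in time). [folklore] -/
private theorem sq_setLIntegral_Ioc_le' {g : ℝ → ℝ≥0∞}
    (hg : AEMeasurable g (volume.restrict (Ioc 0 T))) :
    (∫⁻ s in Ioc 0 T, g s) ^ 2 ≤ ENNReal.ofReal T * ∫⁻ s in Ioc 0 T, g s ^ 2 := by
  have h := sq_lintegral_mul_le (volume.restrict (Ioc 0 T)) (f := fun _ => (1 : ℝ≥0∞)) (g := g)
    aemeasurable_const hg
  simp only [one_mul, one_pow, lintegral_const, Measure.restrict_apply_univ, Real.volume_Ioc,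
    sub_zero] at h
  simpa only [one_mul] using h

/-! ### Integrated bounds: the forcing quantities of the `X¹/X²` recursion -/

/-- **Sup-in-time moments of the forcing term (no gain)** for a jointly measurable force that is
continuous in time at each frequency: for `c, T ≥ 0`, a measurable weight `W` and every `t`,
`∫⁻ (W η ∑ⱼ‖F(t,η)ⱼ‖ₑ)² dη ≤ card² · T · ∫₀ᵀ ∫⁻ (W η ∑ⱼ‖b(s,η)ⱼ‖ₑ)² dη ds`.
[cite: Tao2011, Lemma 2.1 (arXiv Lemma 23), (energy-duh2)] -/
theorem lintegral_weight_majorant_forcing_sq_le' (hc : 0 ≤ c) (hT : 0 ≤ T)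
    (hbm : Measurable (uncurry b)) (hbt : ∀ ξ, Continuous fun s => b s ξ)
    {W : EuclideanSpace ℝ ι → ℝ≥0∞} (hW : Measurable W) (t : ℝ) :
    ∫⁻ η, (W η * ∑ j, ‖forcing c T b t η j‖ₑ) ^ 2 ≤
      (Fintype.card ι : ℝ≥0∞) ^ 2 * ENNReal.ofReal T *
        ∫⁻ s in Ioc 0 T, ∫⁻ η, (W η * ∑ j, ‖b s η j‖ₑ) ^ 2 := by
  set Mb : ℝ → EuclideanSpace ℝ ι → ℝ≥0∞ := fun s η => ∑ j, ‖b s η j‖ₑ with hMb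
  have hMbm : ∀ η, AEMeasurable (fun s => Mb s η) (volume.restrict (Ioc 0 T)) := fun η => by
    refine Finset.aemeasurable_fun_sum _ fun j _ => ?_
    exact (continuous_time_apply hbt η j).measurable.enorm.aemeasurable
  -- pointwise bound in `η`
  have hpt : ∀ η, (W η * ∑ j, ‖forcing c T b t η j‖ₑ) ^ 2 ≤
      (Fintype.card ι : ℝ≥0∞) ^ 2 * ENNReal.ofReal T * ∫⁻ s in Ioc 0 T, (W η * Mb s η) ^ 2 := by
    intro η
    calc (W η * ∑ j, ‖forcing c T b t η j‖ₑ) ^ 2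
        ≤ (W η * ((Fintype.card ι : ℝ≥0∞) * ∫⁻ s in Ioc 0 T, Mb s η)) ^ 2 := by
          gcongr; exact majorant_forcing_le hc hT t η
      _ = (Fintype.card ι : ℝ≥0∞) ^ 2 * (W η * ∫⁻ s in Ioc 0 T, Mb s η) ^ 2 := by ring
      _ = (Fintype.card ι : ℝ≥0∞) ^ 2 * (∫⁻ s in Ioc 0 T, W η * Mb s η) ^ 2 := by
          rw [lintegral_const_mul'' _ (hMbm η)]
      _ ≤ (Fintype.card ι : ℝ≥0∞) ^ 2 * (ENNReal.ofReal T * ∫⁻ s in Ioc 0 T, (W η * Mb s η) ^ 2) := by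
          gcongr; exact sq_setLIntegral_Ioc_le' ((hMbm η).const_mul _)
      _ = _ := by ring
  -- integrate and swap
  have hsw := lintegral_lintegral_swap (μ := (volume : Measure (EuclideanSpace ℝ ι)))
    (ν := volume.restrict (Ioc 0 T)) (f := fun η s => (W η * Mb s η) ^ 2)
    (aemeasurable_weight_majorant_sq' hbm hW (volume.restrict (Ioc 0 T)))
  calc ∫⁻ η, (W η * ∑ j, ‖forcing c T b t η j‖ₑ) ^ 2
      ≤ ∫⁻ η, (Fintype.card ι : ℝ≥0∞) ^ 2 * ENNReal.ofReal T * ∫⁻ s in Ioc 0 T, (W η * Mb s η) ^ 2 :=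
        lintegral_mono hpt
    _ = (Fintype.card ι : ℝ≥0∞) ^ 2 * ENNReal.ofReal T * ∫⁻ η, ∫⁻ s in Ioc 0 T, (W η * Mb s η) ^ 2 :=
        lintegral_const_mul' _ _ (ENNReal.mul_ne_top (by simp) ENNReal.ofReal_ne_top)
    _ = (Fintype.card ι : ℝ≥0∞) ^ 2 * ENNReal.ofReal T * ∫⁻ s in Ioc 0 T, ∫⁻ η, (W η * Mb s η) ^ 2 := by
        rw [hsw]

/-- **Sup-in-time moments of the forcing term under a sup bound on the force** (measurable force,
continuous in time at each frequency): if `∫⁻ (W η ∑ⱼ‖b(s,η)ⱼ‖ₑ)² ≤ β` for `s ∈ (0, T]` then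
`∫⁻ (W η ∑ⱼ‖F(t,η)ⱼ‖ₑ)² ≤ card² T² β` for every `t`.
[cite: Tao2011, Lemma 2.1 (arXiv Lemma 23), (energy-duh2)] -/
theorem lintegral_weight_majorant_forcing_sq_le_of_sup' (hc : 0 ≤ c) (hT : 0 ≤ T)
    (hbm : Measurable (uncurry b)) (hbt : ∀ ξ, Continuous fun s => b s ξ)
    {W : EuclideanSpace ℝ ι → ℝ≥0∞} (hW : Measurable W) {β : ℝ≥0∞}
    (hβ : ∀ s ∈ Ioc 0 T, ∫⁻ η, (W η * ∑ j, ‖b s η j‖ₑ) ^ 2 ≤ β) (t : ℝ) :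
    ∫⁻ η, (W η * ∑ j, ‖forcing c T b t η j‖ₑ) ^ 2 ≤
      (Fintype.card ι : ℝ≥0∞) ^ 2 * ENNReal.ofReal T ^ 2 * β := by
  refine (lintegral_weight_majorant_forcing_sq_le' hc hT hbm hbt hW t).trans ?_
  have h : ∫⁻ s in Ioc 0 T, ∫⁻ η, (W η * ∑ j, ‖b s η j‖ₑ) ^ 2 ≤ ENNReal.ofReal T * β :=
    calc ∫⁻ s in Ioc 0 T, ∫⁻ η, (W η * ∑ j, ‖b s η j‖ₑ) ^ 2 ≤ ∫⁻ _s in Ioc 0 T, β :=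
          setLIntegral_mono' measurableSet_Ioc fun s hs => hβ s hs
      _ = ENNReal.ofReal T * β := by rw [setLIntegral_const, Real.volume_Ioc, sub_zero, mul_comm]
  calc (Fintype.card ι : ℝ≥0∞) ^ 2 * ENNReal.ofReal T * ∫⁻ s in Ioc 0 T, ∫⁻ η, (W η * ∑ j, ‖b s η j‖ₑ) ^ 2
      ≤ (Fintype.card ι : ℝ≥0∞) ^ 2 * ENNReal.ofReal T * (ENNReal.ofReal T * β) :=
        mul_le_mul' le_rfl h
    _ = _ := by ring

/-- **`L²`-in-time moments of the forcing term with the heat gain** (measurable force, continuous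
in time at each frequency): for `c > 0` and every `k`,
`∫₀ᵀ ∫⁻ (‖η‖^{k+1} ∑ⱼ‖F(t,η)ⱼ‖ₑ)² dη dt ≤ card² (2c)⁻¹ T ∫₀ᵀ ∫⁻ (‖η‖^k ∑ⱼ‖b(s,η)ⱼ‖ₑ)² dη ds`.
[cite: Tao2011, Lemma 2.1 (arXiv Lemma 23), (energy-duh2)] -/
theorem lintegral_time_weight_majorant_forcing_sq_le' (hc : 0 < c)
    (hbm : Measurable (uncurry b)) (hbt : ∀ ξ, Continuous fun s => b s ξ) (k : ℕ) :
    ∫⁻ t in Ioc 0 T, ∫⁻ η, (ENNReal.ofReal (‖η‖ ^ (k + 1)) * ∑ j, ‖forcing c T b t η j‖ₑ) ^ 2 ≤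
      (Fintype.card ι : ℝ≥0∞) ^ 2 * ENNReal.ofReal (1 / (2 * c)) * ENNReal.ofReal T *
        ∫⁻ s in Ioc 0 T, ∫⁻ η, (ENNReal.ofReal (‖η‖ ^ k) * ∑ j, ‖b s η j‖ₑ) ^ 2 := by
  set Mb : ℝ → EuclideanSpace ℝ ι → ℝ≥0∞ := fun s η => ∑ j, ‖b s η j‖ₑ with hMb
  set C : ℝ≥0∞ := (Fintype.card ι : ℝ≥0∞) ^ 2 * ENNReal.ofReal (1 / (2 * c)) with hC
  have hWk : Measurable fun η : EuclideanSpace ℝ ι => ENNReal.ofReal (‖η‖ ^ k) :=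
    (ENNReal.continuous_ofReal.comp (continuous_norm.pow k)).measurable
  -- the time-uniform pointwise bound at each frequency
  have hpt : ∀ t ∈ Icc 0 T, ∀ η,
      (ENNReal.ofReal (‖η‖ ^ (k + 1)) * ∑ j, ‖forcing c T b t η j‖ₑ) ^ 2 ≤
        C * ∫⁻ s in Ioc 0 T, (ENNReal.ofReal (‖η‖ ^ k) * Mb s η) ^ 2 := by
    intro t ht η
    have hgain := norm_sq_mul_enorm_forcing_sq_le' (b := b) hc hbt ht η
    have hsplit : ENNReal.ofReal (‖η‖ ^ (k + 1)) = ENNReal.ofReal (‖η‖ ^ k) * ENNReal.ofReal ‖η‖ := by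
      rw [← ENNReal.ofReal_mul (by positivity), pow_succ]
    calc (ENNReal.ofReal (‖η‖ ^ (k + 1)) * ∑ j, ‖forcing c T b t η j‖ₑ) ^ 2
        ≤ (ENNReal.ofReal (‖η‖ ^ (k + 1)) * ((Fintype.card ι : ℝ≥0∞) * ‖forcing c T b t η‖ₑ)) ^ 2 := by
          gcongr
          calc (∑ j, ‖forcing c T b t η j‖ₑ) ≤ ∑ _j : ι, ‖forcing c T b t η‖ₑ :=
                Finset.sum_le_sum fun j _ => enorm_apply_le_enorm_pi' _ j
            _ = (Fintype.card ι : ℝ≥0∞) * ‖forcing c T b t η‖ₑ := by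
                simp [Finset.sum_const, Finset.card_univ]
      _ = (Fintype.card ι : ℝ≥0∞) ^ 2 * ENNReal.ofReal (‖η‖ ^ k) ^ 2 *
          (ENNReal.ofReal ‖η‖ ^ 2 * ‖forcing c T b t η‖ₑ ^ 2) := by rw [hsplit]; ring
      _ = (Fintype.card ι : ℝ≥0∞) ^ 2 * ENNReal.ofReal (‖η‖ ^ k) ^ 2 *
          (ENNReal.ofReal (‖η‖ ^ 2) * ‖forcing c T b t η‖ₑ ^ 2) := by
          rw [← ENNReal.ofReal_pow (norm_nonneg η)]
      _ ≤ (Fintype.card ι : ℝ≥0∞) ^ 2 * ENNReal.ofReal (‖η‖ ^ k) ^ 2 *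
          (ENNReal.ofReal (1 / (2 * c)) * ∫⁻ s in Ioc 0 T, ‖b s η‖ₑ ^ 2) := by gcongr
      _ = C * (ENNReal.ofReal (‖η‖ ^ k) ^ 2 * ∫⁻ s in Ioc 0 T, ‖b s η‖ₑ ^ 2) := by rw [hC]; ring
      _ = C * ∫⁻ s in Ioc 0 T, ENNReal.ofReal (‖η‖ ^ k) ^ 2 * ‖b s η‖ₑ ^ 2 := by
          rw [lintegral_const_mul' _ _ (ENNReal.pow_ne_top ENNReal.ofReal_ne_top)]
      _ ≤ C * ∫⁻ s in Ioc 0 T, (ENNReal.ofReal (‖η‖ ^ k) * Mb s η) ^ 2 := by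
          gcongr with s
          rw [mul_pow]
          gcongr
          exact enorm_pi_le_majorant' (b s η)
  -- integrate over `t`, then swap `η` and `s`
  have hsw := lintegral_lintegral_swap (μ := (volume : Measure (EuclideanSpace ℝ ι)))
    (ν := volume.restrict (Ioc 0 T)) (f := fun η s => (ENNReal.ofReal (‖η‖ ^ k) * Mb s η) ^ 2)
    (aemeasurable_weight_majorant_sq' hbm hWk (volume.restrict (Ioc 0 T)))
  calc ∫⁻ t in Ioc 0 T, ∫⁻ η, (ENNReal.ofReal (‖η‖ ^ (k + 1)) * ∑ j, ‖forcing c T b t η j‖ₑ) ^ 2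
      ≤ ∫⁻ _t in Ioc 0 T, ∫⁻ η, C * ∫⁻ s in Ioc 0 T, (ENNReal.ofReal (‖η‖ ^ k) * Mb s η) ^ 2 :=
        setLIntegral_mono' measurableSet_Ioc fun t ht => lintegral_mono (hpt t ⟨ht.1.le, ht.2⟩)
    _ = ENNReal.ofReal T * (C * ∫⁻ η, ∫⁻ s in Ioc 0 T, (ENNReal.ofReal (‖η‖ ^ k) * Mb s η) ^ 2) := by
        rw [setLIntegral_const, Real.volume_Ioc, sub_zero, mul_comm, lintegral_const_mul' _ _ ?_]
        exact ENNReal.mul_ne_top (by simp) ENNReal.ofReal_ne_top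
    _ = C * ENNReal.ofReal T * ∫⁻ s in Ioc 0 T, ∫⁻ η, (ENNReal.ofReal (‖η‖ ^ k) * Mb s η) ^ 2 := by
        rw [hsw]; ring
    _ = _ := by rw [hC]

/-- **`L²`-in-time moments of the forcing term under a sup bound on the force** (measurable force,
continuous in time at each frequency): if `∫⁻ (‖η‖^k ∑ⱼ‖b(s,η)ⱼ‖ₑ)² ≤ β` for `s ∈ (0, T]` then
`∫₀ᵀ ∫⁻ (‖η‖^{k+1} ∑ⱼ‖F(t,η)ⱼ‖ₑ)² ≤ card² (2c)⁻¹ T² β`.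
[cite: Tao2011, Lemma 2.1 (arXiv Lemma 23), (energy-duh2)] -/
theorem lintegral_time_weight_majorant_forcing_sq_le_of_sup' (hc : 0 < c)
    (hbm : Measurable (uncurry b)) (hbt : ∀ ξ, Continuous fun s => b s ξ) (k : ℕ) {β : ℝ≥0∞}
    (hβ : ∀ s ∈ Ioc 0 T, ∫⁻ η, (ENNReal.ofReal (‖η‖ ^ k) * ∑ j, ‖b s η j‖ₑ) ^ 2 ≤ β) :
    ∫⁻ t in Ioc 0 T, ∫⁻ η, (ENNReal.ofReal (‖η‖ ^ (k + 1)) * ∑ j, ‖forcing c T b t η j‖ₑ) ^ 2 ≤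
      (Fintype.card ι : ℝ≥0∞) ^ 2 * ENNReal.ofReal (1 / (2 * c)) * ENNReal.ofReal T ^ 2 * β := by
  refine (lintegral_time_weight_majorant_forcing_sq_le' hc hbm hbt k).trans ?_
  have h : ∫⁻ s in Ioc 0 T, ∫⁻ η, (ENNReal.ofReal (‖η‖ ^ k) * ∑ j, ‖b s η j‖ₑ) ^ 2 ≤
      ENNReal.ofReal T * β :=
    calc ∫⁻ s in Ioc 0 T, ∫⁻ η, (ENNReal.ofReal (‖η‖ ^ k) * ∑ j, ‖b s η j‖ₑ) ^ 2
        ≤ ∫⁻ _s in Ioc 0 T, β := setLIntegral_mono' measurableSet_Ioc fun s hs => hβ s hs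
      _ = ENNReal.ofReal T * β := by rw [setLIntegral_const, Real.volume_Ioc, sub_zero, mul_comm]
  calc (Fintype.card ι : ℝ≥0∞) ^ 2 * ENNReal.ofReal (1 / (2 * c)) * ENNReal.ofReal T *
        ∫⁻ s in Ioc 0 T, ∫⁻ η, (ENNReal.ofReal (‖η‖ ^ k) * ∑ j, ‖b s η j‖ₑ) ^ 2
      ≤ (Fintype.card ι : ℝ≥0∞) ^ 2 * ENNReal.ofReal (1 / (2 * c)) * ENNReal.ofReal T *
        (ENNReal.ofReal T * β) := mul_le_mul' le_rfl h
    _ = _ := by ring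

end Literature.Analysis.FluidPDE.FourierNS

end
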